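import Summits.ResolutionOfSingularities.ResolutionOfSingularities.Theorems.FrobeniusLadderFInjectiveMacaulayficationLaurentCoaction
import Mathlib.RingTheory.MvPolynomial.WeightedHomogeneous
import Mathlib.RingTheory.Localization.Away.Basic
import Mathlib.RingTheory.Ideal.Quotient.Operations
import HarnessLib

/-!
# The `ℤ`-weight coaction on `(k[Xσ]/(g))[1/u]` for arbitrary variables and integer weights (§17 G4♮, piece (F1))

Support file for crux stmt-ResolutionOfSingularities-15315 (`FrobeniusLadder.FInjectiveMacaulayfication`,
filtered engine §17 / G4♮, CRUX-PLAN w45a v5 §1.3 piece (F1), owner stub-4). [OURS · L1 W4.5a]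

`WeightCoaction.exists_coaction` (lead res-L1-w45a-lead-1, H-G1) grades `(k[X₁..Xₙ]/(f))[1/u]` for `ℕ`-weights on
`Fin n`. The filtered carrier (F0) of res-L1-w45a-stub-3 is `(k[X_σ]/(f^h))[1/X_v^c]` with `σ = Option (Fin n)`,
`s = X none` of weight `-1` — integer weights on an arbitrary index type. This file is that generalisation, in the
`single`-convention of `…LaurentCoaction`:

* `aeval_single_of_isWeightedHomogeneous` — substituting `X_i ↦ g_i · T^{w_i}` (`w : σ → ℤ`) into a weighted homogeneous
  polynomial of weight `d` gives `φ(g) · T^d`;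
* `ringHom_ext_away` — ring maps out of `(k[X_σ]/(g))[1/u]` are determined on `k` and on the classes of the variables;
* `exists_weightCoactionZ` — for `g` weighted homogeneous and `u` the class of a weighted homogeneous `U` of weight `N`,
  the coaction `β : L →+* L[T;T⁻¹]`, `L = (k[X_σ]/(g))[1/u]`, with its interface: values on variables, on `k`, on classes
  of weighted homogeneous polynomials, COUNIT and COASSOCIATIVITY (from `counit_of_ext` / `coassoc_of_ext`).

No primality or reducedness is used. Folklore; no definitions, no named facts.
-/

-- single-problem summit: the doubled namespace component is forced
set_option linter.dupNamespace false

noncomputable section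

open scoped LaurentPolynomial
open AddMonoidAlgebra LaurentPolynomial MvPolynomial
open Summit.ResolutionOfSingularities.ResolutionOfSingularities.Theorems.FInjectiveMacaulayfication
open Summit.ResolutionOfSingularities.ResolutionOfSingularities.Theorems.FInjectiveMacaulayfication.LaurentCoaction

namespace Summit.ResolutionOfSingularities.ResolutionOfSingularities.Theorems.FInjectiveMacaulayfication.WeightCoactionZ

variable {k : Type} [Field k] {σ : Type} (w : σ → ℤ)

/-! ## Weighted substitution into Laurent monomials -/

/-- `single d` is additive (Finset sums). [folklore] -/
theorem single_finset_sum {A : Type} [CommRing A] {ι : Type*} (s : Finset ι) (g : ι → A) (d : ℤ) :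
    (single d (∑ i ∈ s, g i) : A[T;T⁻¹]) = ∑ i ∈ s, single d (g i) :=
  map_sum (singleAddHom d) g s

/-- **Weighted substitution.** Substituting `X_i ↦ g_i · T^{w_i}` (integer weights) into a weighted homogeneous
polynomial `φ` of weight `d` gives `φ(g) · T^d`. [folklore] -/
theorem aeval_single_of_isWeightedHomogeneous {A : Type} [CommRing A] [Algebra k A] (g : σ → A)
    {φ : MvPolynomial σ k} {d : ℤ} (hφ : IsWeightedHomogeneous w φ d) :
    MvPolynomial.aeval (fun j => (single (w j) (g j) : A[T;T⁻¹])) φ = single d (MvPolynomial.aeval g φ) := by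
  classical
  have key : ∀ (b : σ →₀ ℕ) (c : k),
      MvPolynomial.aeval (fun j => (single (w j) (g j) : A[T;T⁻¹])) (monomial b c) =
        single (Finsupp.weight w b) (MvPolynomial.aeval g (monomial b c)) := by
    intro b c
    simp only [MvPolynomial.aeval_monomial, LaurentPolynomial.algebraMap_apply, ← single_eq_C, Finsupp.prod,
      single_pow, prod_single, single_mul_single, zero_add]
    rfl
  conv_lhs => rw [φ.as_sum, map_sum]
  conv_rhs => rw [φ.as_sum, map_sum, single_finset_sum]
  refine Finset.sum_congr rfl fun b hb => ?_
  rw [key, hφ (mem_support_iff.mp hb)]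

/-! ## Ring maps out of `(k[X_σ]/(g))[1/u]` -/

/-- Two ring maps out of `(k[X_σ]/(g))[1/u]` that agree on `k` and on the classes of the variables are equal. [folklore] -/
theorem ringHom_ext_away (f : MvPolynomial σ k) (u : MvPolynomial σ k ⧸ Ideal.span {f})
    (X' : Type) [CommRing X']
    (φ ψ : Localization.Away u →+* X')
    (hk : ∀ c : k, φ (algebraMap k (Localization.Away u) c) = ψ (algebraMap k (Localization.Away u) c))
    (hX : ∀ g ∈ Set.range (fun j : σ => algebraMap (MvPolynomial σ k ⧸ Ideal.span {f})
      (Localization.Away u) (Ideal.Quotient.mk (Ideal.span {f}) (MvPolynomial.X j))), φ g = ψ g) :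
    φ = ψ := by
  refine IsLocalization.ringHom_ext (Submonoid.powers u) (Ideal.Quotient.ringHom_ext (MvPolynomial.ringHom_ext ?_ ?_))
  · intro c
    simp only [RingHom.comp_apply]
    have h : (Ideal.Quotient.mk (Ideal.span {f})) (MvPolynomial.C c) =
        algebraMap k (MvPolynomial σ k ⧸ Ideal.span {f}) c := rfl
    rw [h, ← IsScalarTower.algebraMap_apply]
    exact hk c
  · intro j
    simp only [RingHom.comp_apply]
    exact hX _ ⟨j, rfl⟩

/-! ## The coaction -/

/-- **THE `ℤ`-WEIGHT COACTION ON `(k[X_σ]/(g))[1/u]`.** For `f` weighted homogeneous (integer weights `w : σ → ℤ`,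
weight `D`) and `u` the class of a weighted homogeneous `U` of weight `N`, there is a ring map `β : L →+* L[T;T⁻¹]`,
`L = (k[X_σ]/(f))[1/u]`, with `β (x̄ⱼ/1) = single wⱼ (x̄ⱼ/1)`, `β|ₖ = C`, `β (φ̄/1) = single d (φ̄/1)` for `φ` weighted
homogeneous of weight `d`, counit `ε ∘ β = id` and homogeneous components. [folklore] -/
theorem exists_weightCoactionZ (f : MvPolynomial σ k) (D : ℤ) (hf : IsWeightedHomogeneous w f D)
    (U : MvPolynomial σ k) (N : ℤ) (hU : IsWeightedHomogeneous w U N)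
    (u : MvPolynomial σ k ⧸ Ideal.span {f}) (huU : Ideal.Quotient.mk (Ideal.span {f}) U = u) :
    ∃ β : Localization.Away u →+* (Localization.Away u)[T;T⁻¹],
      (∀ j : σ, β (algebraMap _ (Localization.Away u) (Ideal.Quotient.mk (Ideal.span {f}) (MvPolynomial.X j))) =
        single (w j) (algebraMap _ (Localization.Away u) (Ideal.Quotient.mk (Ideal.span {f}) (MvPolynomial.X j)))) ∧
      (∀ c : k, β (algebraMap k (Localization.Away u) c) = LaurentPolynomial.C (algebraMap k (Localization.Away u) c)) ∧
      (∀ (φ : MvPolynomial σ k) (d : ℤ), IsWeightedHomogeneous w φ d →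
        β (algebraMap _ (Localization.Away u) (Ideal.Quotient.mk (Ideal.span {f}) φ)) =
          single d (algebraMap _ (Localization.Away u) (Ideal.Quotient.mk (Ideal.span {f}) φ))) ∧
      (∀ ℓ : Localization.Away u, LaurentPolynomial.eval₂ (RingHom.id (Localization.Away u)) 1 (β ℓ) = ℓ) ∧
      (∀ (ℓ : Localization.Away u) (i : ℤ), β ((β ℓ).coeff i) = single i ((β ℓ).coeff i)) := by
  set mk : MvPolynomial σ k →+* (MvPolynomial σ k ⧸ Ideal.span {f}) := Ideal.Quotient.mk (Ideal.span {f})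
    with hmk
  let g : σ → Localization.Away u := fun j => algebraMap (MvPolynomial σ k ⧸ Ideal.span {f}) (Localization.Away u)
    (mk (MvPolynomial.X j))
  -- the substitution `Xⱼ ↦ x̄ⱼ T^{wⱼ}`
  let βS : MvPolynomial σ k →ₐ[k] (Localization.Away u)[T;T⁻¹] := MvPolynomial.aeval fun j => single (w j) (g j)
  have hg : ∀ φ : MvPolynomial σ k, MvPolynomial.aeval g φ =
      algebraMap (MvPolynomial σ k ⧸ Ideal.span {f}) (Localization.Away u) (mk φ) := by
    intro φ
    have h := MvPolynomial.aeval_unique ((IsScalarTower.toAlgHom k (MvPolynomial σ k ⧸ Ideal.span {f})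
      (Localization.Away u)).comp (Ideal.Quotient.mkₐ k (Ideal.span {f})))
    have hcomp : ⇑((IsScalarTower.toAlgHom k (MvPolynomial σ k ⧸ Ideal.span {f}) (Localization.Away u)).comp
        (Ideal.Quotient.mkₐ k (Ideal.span {f}))) ∘ MvPolynomial.X = g := rfl
    rw [hcomp] at h
    rw [← h]
    rfl
  have hβS : ∀ (φ : MvPolynomial σ k) (d : ℤ), IsWeightedHomogeneous w φ d →
      βS φ = single d (algebraMap (MvPolynomial σ k ⧸ Ideal.span {f}) (Localization.Away u) (mk φ)) := by
    intro φ d hφ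
    rw [← hg]
    exact aeval_single_of_isWeightedHomogeneous w g hφ
  -- it kills `(f)`
  have hβSf : ∀ a ∈ Ideal.span {f}, βS a = 0 := by
    intro a ha
    obtain ⟨b, rfl⟩ := Ideal.mem_span_singleton'.mp ha
    rw [map_mul, hβS f D hf]
    have h0 : mk f = 0 := Ideal.Quotient.eq_zero_iff_mem.mpr (Ideal.mem_span_singleton_self f)
    rw [h0, map_zero, single_zero, mul_zero]
  let βR : (MvPolynomial σ k ⧸ Ideal.span {f}) →ₐ[k] (Localization.Away u)[T;T⁻¹] :=
    Ideal.Quotient.liftₐ (Ideal.span {f}) βS hβSf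
  have hβR : ∀ φ, βR (mk φ) = βS φ := fun φ => by
    show Ideal.Quotient.lift (Ideal.span {f}) (βS : _ →+* _) hβSf (mk φ) = βS φ
    exact Ideal.Quotient.lift_mk _ _ _
  -- `u ↦ ū T^N` is a unit
  have hβRu : βR u = single N (algebraMap (MvPolynomial σ k ⧸ Ideal.span {f}) (Localization.Away u) u) := by
    have h1 := hβR U
    have h2 := hβS U N hU
    rw [huU] at h1 h2
    exact h1.trans h2
  have hunit : IsUnit (βR.toRingHom u) := by
    show IsUnit (βR u)
    rw [hβRu, single_eq_C_mul_T]
    exact ((IsLocalization.Away.algebraMap_isUnit (S := Localization.Away u) u).map LaurentPolynomial.C).mul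
      (isUnit_T _)
  let β : Localization.Away u →+* (Localization.Away u)[T;T⁻¹] := IsLocalization.Away.lift u hunit
  have hβ : ∀ r : MvPolynomial σ k ⧸ Ideal.span {f},
      β (algebraMap (MvPolynomial σ k ⧸ Ideal.span {f}) (Localization.Away u) r) = βR r :=
    fun r => IsLocalization.Away.lift_eq u hunit r
  have hX : ∀ j : σ, β (g j) = single (w j) (g j) := by
    intro j
    show β (algebraMap (MvPolynomial σ k ⧸ Ideal.span {f}) (Localization.Away u) (mk (MvPolynomial.X j))) = _
    rw [hβ, hβR, hβS _ (w j) (isWeightedHomogeneous_X k w j)]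
  have hk : ∀ c : k, β (algebraMap k (Localization.Away u) c) =
      LaurentPolynomial.C (algebraMap k (Localization.Away u) c) := by
    intro c
    rw [IsScalarTower.algebraMap_apply k (MvPolynomial σ k ⧸ Ideal.span {f}) (Localization.Away u), hβ,
      AlgHom.commutes, LaurentPolynomial.algebraMap_apply, ← IsScalarTower.algebraMap_apply]
  have hext : ∀ (X' : Type) [CommRing X'] (φ ψ : Localization.Away u →+* X'),
      (∀ c : k, φ (algebraMap k (Localization.Away u) c) = ψ (algebraMap k (Localization.Away u) c)) →
      (∀ g' ∈ Set.range g, φ g' = ψ g') → φ = ψ :=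
    fun X' _ φ ψ h1 h2 => ringHom_ext_away f u X' φ ψ h1 h2
  have hG : ∀ g' ∈ Set.range g, ∃ d : ℤ, β g' = single d g' := by
    rintro _ ⟨j, rfl⟩
    exact ⟨w j, hX j⟩
  refine ⟨β, hX, hk, fun φ d hφ => ?_, counit_of_ext β (Set.range g) hext hG hk,
    coassoc_of_ext β (Set.range g) hext hG hk⟩
  rw [hβ, hβR, hβS φ d hφ]

end Summit.ResolutionOfSingularities.ResolutionOfSingularities.Theorems.FInjectiveMacaulayfication.WeightCoactionZ

end
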